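import Literature.MathematicalPhysics.QuantumFieldTheory.Balaban1983to89.B9SectCWalkTermsAllNorms

/-!
# `Balaban1983to89.B9SectDERandomWalkClauses` — [Balaban1985BackgroundPropagators] Sects. D–E: the RANDOM-WALK CLAUSES of
# Theorems 3.12 ∕ 3.13 (*«Theorems 3.3, 3.10, 3.11 hold for the propagators G, G₁ … the inequality (3.133) together with
# Theorem 3.10 hold for the operators H, H₁»*, *«… for the propagator 𝔊»*), Theorem 3.14 for the H-kernels and the site
# kernels, the γ₀ sentence of p. 428, and Theorem 3.15's *«convergent random walk expansion of the type described
# previously»* — typed in printed shape over the carriers of `…Balaban1983to89.B9`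

statement-level skeleton of published theorems with citation tags; proofs where landed; nothing here is a claim about the
Yang–Mills mass gap

T. Bałaban, *Propagators for lattice gauge theories in a background field*, Commun. Math. Phys. **99**, 389–434 (1985)
[Balaban1985BackgroundPropagators] (cell paper B9; PDF held `paper:balaban1985-cmp99-background-propagators`, journal page =
PDF page + 388; pp. 416, 421–428, 432 re-read on the held text layer by this seat, 2026-08-26); its [4] = [Balaban1984PropagatorsII],
its [2] = [Balaban1983RegularityDecay].

CITATION HEADER (lean-in-tree rule).  THE PRINTED LOCI (verbatim).  p. 423 [PDF 35]: *"The convergence is in all norms appearing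
in the formulation of Theorem 3.3. This implies that the theorem is valid for G₁. Replacing the operators in (3.138) by their
random walk expansions we get a random walk expansion for G₁. From (3.129) and (3.132) with G₁ instead of G we get the
inequalities (3.133) for H₁. Thus we have Theorem 3.12. If an external gauge field configuration U satisfies both regularity
conditions (3.35), (3.36) for α₀ sufficiently small, then Theorems 3.3, 3.10, 3.11 hold for the propagators G, G₁, with one
exception and the inequality (1.133) [sic: (3.133), G-B9-04] together with Theorem 3.10 hold for the operators H, H₁. The
exception is the inequality in (3.42) involving the covariant Laplace operator. It does not hold for G, G₁. Let us denote a
common, best possible, decay rate for all these operators by δ₀."*; p. 426 [PDF 38]: *"Especially for 𝔊 we have, assuming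
(3.132) Theorem 3.13. If an external gauge field configuration U satisfies the regularity conditions (3.35), (3.36) for α₀
sufficiently small, then Theorems 3.3, 3.10, 3.11 hold for the propagator 𝔊, with the exception of the inequality in (3.42)
involving the covariant Laplace operator."*; p. 426: *"Let us take localizations determined by points y, y′ ∈ Ω^{(k)} (i.e. these
are cubes Δ(y), Δ(y′) in the case of operators G′, G, G₁, 𝔊, the cube Δ(y) and the point y′ in the case of H, H₁, and the points
y, y′ in the case of (Q′G′²Q′*)⁻¹, (QGQ*)⁻¹, etc.). We have Theorem 3.14. If we take a pair of operators constructed for the two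
sequences {Ω_j}, {Ω′_j}, then their difference satisfies all the inequalities characteristic for operators of the considered type,
with the additional factor exp(−δ₀d(y, y′, Ω)), d(y, y′, Ω) = inf_{y₁∈Ωᶜ∩T^{(k)}}(|y − y₁| + |y₁ − y′|) (3.154) on the right-hand
sides."*; p. 427 [PDF 39]: *"Finally, let us make a remark about the random walk expansions for the operators G₁, H₁. The
expansion for G₁ is obtained from (3.138) by inserting there the expansions of all operators in the series on the right-hand
side. … Thus instead of a linear chain, or walk, appearing in the formulation of Theorem 3.10, we have an expansion (3.107) with
ω having a tree-like structure. … The estimates are the same as in (3.108), d(ω, y, y′) is now a length of a shortest tree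
intersecting all domains Xᵢ in ω. We call these expansions random walk expansions also. We have the same situation for the
operators H₁."*; p. 428 [PDF 40]: *"It is more convenient to work with the operator C̃^{(k)}(Λ), because it is defined by a
positive definite operator C*Δ_kC with a lower bound γ₀ > 0 independent of k and U. We have proved it in [4], Lemma 2.4, for
operators with U = 1. Localizing the operators in Δ_k and using the methods of Sect. B we can prove it for C*Δ_kC with an
arbitrary configuration U satisfying (3.35), (3.36) with Mα₀ sufficiently small."*; p. 432 [PDF 44]: *"This way we can express
C^{(k)}(Λ) in terms of the operators of the type G′, (Q′G′²Q′*)⁻¹, G, (QGQ*)⁻¹. Expanding these into random walks we get a random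
walk expansion of C^{(k)}(Λ). The formula (3.185) implies immediately bounds and an exponential decay. Thus we get Theorem 3.15.
… This propagator has a convergent random walk expansion of the type described previously. Of course we have all the other
consequences following from the random walk expansion."*

WHY THIS FILE (cell `lit-balaban`, seat `lit-balaban-type-B9` g0 = R141 (B) typer «[B9] Thms 3.9–3.15, Cor 3.8 → N06»;
count-neutral).  `B9.lean` carries the Theorem-3.10 clauses of Theorems 3.12∕3.13 and the expansion clause of Theorem 3.15 as
ABSTRACT PREDICATE PARAMETERS (`HasRWExp`, `HasRWExpH`, `HasRWExpC` of `Thm312Printed` ∕ `Thm313Printed` ∕ `Thm315FullPrinted`;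
at the Stage-3′(Y) pin they are free fields of `B9PinCarriersKLevelV1.OperatorLayerY`, whence dag-ref-A's clause «with `ops`
residual the b9 leaf is junk-closable»), Theorem 3.14 only for operators of `KernelFamily` type (`Thm314Printed`,
`B9Thm314.Thm314LocalPrinted`), and the γ₀ sentence of p. 428 only as a GAPS row (G-B9-09; the LOGIC of its repair is
`B9SectEKernel.gamma0_assembly`, cited, not restated).  This file gives these clauses PRINTED-SHAPE bodies at the same carrier
level — the companions a consumer carries BESIDE the r1 statements (never instead of them): the walks ω and their terms are the
carriers `B9.RWExpansion` ∕ `B9.RWKernelExpansion`, the ω-terms are seen through walk-indexed `B9.KernelFamily` ∕ `B9.HKernel`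
(pattern of `B9SectCWalkTermsAllNorms`), the per-term bounds are (3.108) «and the corresponding inequalities» (p. 427: *«The
estimates are the same as in (3.108)»*) resp. (3.133) with the walk factor, the Theorem-3.14 blocks for kernels follow
`B9Thm314.IneqSupF` (restriction y, y′ ∈ Ω^{(k)} + extra factor).

WHAT IS DECLARED (definitions with bodies + kernel-checked bookkeeping; NO theorem of the paper is asserted).
* §1 `TermIneq342_346NoLap` (Thm 3.12's exception: the per-walk (3.42) block WITHOUT the covariant-Laplacian entry n = 3, all of
  (3.46) — the convention of `B9.Ineq342_346_347_noLap`; `termNoLap_of_full`), `RWClause310NoLap` (Theorem 3.10's three clauses for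
  one family at one U: convergent, localized, per-term all-norms-but-Δ_U), `TermIneq3133` + `RWClauseH` (the same for an
  H-kernel: per-term (3.133) shape × walk factor), `Thm312RWPrinted` (G, G₁, H, H₁), `Thm313RWPrinted` (𝔊), projection
  `sup_entry_of_clause`.
* §2 `IneqKerF`, `IneqHF` (the (3.48)∕(3.132)- and (3.133)-shaped blocks with a localisation restriction and an extra factor),
  `Thm314CinvPrinted` ((Q′G′²Q′*)⁻¹, hypotheses of Thm 3.2), `Thm314SectDKernelsPrinted` ((QGQ*)⁻¹, (QG₁Q*)⁻¹, H, H₁, hypotheses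
  of Thm 3.12), `thm314Cinv_iff_univ` (bookkeeping: restriction ≡ True is the unrestricted reading).
* §3 `ClaimP428GammaZeroPrinted` (γ₀, a₀ BEFORE the member i ∋ k and U), `Thm315RWExpansionPrinted` (convergent + localized +
  per-term walk bound on Λ), `thm315RW_converges` (projection).
READING NOTES.  (i) p. 427's tree-like ω: `RWExpansion.Walk` ∕ `wdist` are abstract, so «ω having a tree-like structure … d(ω,y,y′)
… a length of a shortest tree» is a property of the INSTANCE, recorded here, not a further field; (ii) Theorem 3.15: the per-term
display is NOT printed for C^{(k)}(Λ) on p. 432 — «of the type described previously» is read, as in `B9.Thm37_39_310Printed`'s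
docstring of record, as «expansion exists, converges, terms localised with the bound (3.94)∕(3.99)∕(3.108)», here the
(3.99)-pattern for a kernel on Λ with the kernel's own O(1) (no scale powers at the unit scale); (iii) GAPS rows travel with the
names: G-B9-07∕16 (Sect. C∕D proofs by reference + series), G-B9-08∕19 (Thm 3.14 sketch, δ₀ «adjusted»), G-B9-09 (γ₀ asserted —
U = 1 is [4] Lemma 2.4 = G-B6-08; repair logic `B9SectEKernel.gamma0_assembly`, G-B9-09R), G-B9-10 (the G₂ − G₁ perturbation behind
Thm 3.15 undisplayed; kernel companion `B9Eq3186G2Perturbation`), G-B9-11 (no Δ_U entry for Sect.-D operators), G-B9-15 ((3.132) by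
analogy; repair `QGQInverse`).
v1.1 (seat g2, 2026-08-26; APPEND-ONLY — every v1 declaration byte-identical, docstrings extended, §4 appended) answers the
referee reads of record: lit-balaban-ref-2 g138 (`REFEREE-2-R141-g138.md`: PASS 15∕16 + GAP-STATED(`Thm315RWExpansionPrinted`) —
§C-1 «add a verbatim-core `Thm315RWCorePrinted` (= Converges ∧ LocDep, what the page literally asserts) and restate
`thm315RW_converges` against it»; §C-2 «one docstring sentence naming the (2.1)–(2.4)-of-[4] ↦ family-index convention» on
`Thm314CinvPrinted` ∕ `Thm314SectDKernelsPrinted`) and pub-ymgap dag-ref-E READ-7 (PASS; ONE A3 WATCH: `Thm315RWExpansionPrinted`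
carries `B9.walkFactor`'s real powers M^{−1/2} under no M-threshold — at a would-be member with M ≤ 0 the `Real.rpow` junk value
makes the per-term bound degenerate).  §4 adds `Thm315RWCorePrinted` + `thm315RWCore_of_expansion` (§C-1), the thresholded
reading `Thm315RWExpansionLargeMPrinted` (p. 426: *«with M and R sufficiently large, so that all the conditions needed in this
paper are satisfied»*, the `M₄ ≤ M` shape of `Thm312RWPrinted`) + `thm315RWLargeM_of_expansion` + `walkFactor_pos` (A3), and the
§2 docstrings name the convention (§C-2).  Nothing of v1 is weakened or re-typed; consumers of v1 names are unaffected.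
HONEST SCOPE: hypothesis-schema typing over EXISTING carriers; free targets, zero head weight (SKELETON rows B9.Thm3.12–3.15, owner
r06); every `…Printed` is consumed only as a hypothesis; N06 NOT discharged; one finite lattice paper; nothing continuum ∕ ℝ⁴ ∕
OS ∕ mass-gap ∕ Clay.
-/

namespace Literature.MathematicalPhysics.QuantumFieldTheory.Balaban1983to89.B9SectDERandomWalkClauses

open B9 B9SectCWalkTermsAllNorms

variable {g : Geometry} {B : Backgrounds}

/-! ## §1 Theorems 3.12 ∕ 3.13: the Theorem-3.10 clauses for G, G₁, 𝔊 and for H, H₁ -/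

/-- **THE PER-WALK (3.42)∕(3.46) BLOCK WITHOUT THE COVARIANT-LAPLACIAN ENTRY** — Theorem 3.12's *"exception … the inequality in
(3.42) involving the covariant Laplace operator. It does not hold for G, G₁"* applied to the per-term clause *"the corresponding
inequalities for norms on the left-hand sides of (3.42)–(3.47)"* of Theorem 3.10: entry n = 3 of (3.42) is dropped, all six
entries of (3.46) kept (the convention of `B9.Ineq342_346_347_noLap`, interface warning G-B9-11).
[cite: Balaban1985BackgroundPropagators, Thm 3.12 p.423, Thm 3.10 (3.108) p.416, (3.42) p.397, (3.46) p.398] -/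
def TermIneq342_346NoLap (E : RWExpansion g B) (termK : E.Walk → KernelFamily g B) (C c δ₀ : ℝ) (U : B.Cfg) : Prop :=
  (∀ (ω : E.Walk) (n : Fin 4) (lam : g.Loc) (y y' : g.Site), n ≠ 3 → E.first ω y → E.last ω y' → g.suppIn lam y' →
      (termK ω).e n U lam y ≤
        pref4 (g.len y) n * walkFactor C c g.M δ₀ (E.wlen ω) (E.wdist ω y y') * g.supNorm lam) ∧
  (∀ (ω : E.Walk) (n : Fin 6) (lam : g.Loc) (h : g.Cut) (y y' : g.Site), E.first ω y → E.last ω y' →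
      g.cutIn h y → g.suppIn lam y' →
      (termK ω).l2 n U lam h ≤
        pref6 (g.len y) n * g.cutSup h * walkFactor C c g.M δ₀ (E.wlen ω) (E.wdist ω y y') * g.l2Norm lam)

/-- Bookkeeping (kernel-checked): the full per-walk block implies the block without the Laplacian entry — the direction in
which Theorems 3.12∕3.13 weaken Theorem 3.10 (as `B9.noLap_of_full` for the operator blocks). [cite: Balaban1985BackgroundPropagators, Thm 3.12 p.423] -/
theorem termNoLap_of_full {E : RWExpansion g B} {termK : E.Walk → KernelFamily g B} {C c δ₀ : ℝ} {U : B.Cfg}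
    (h : TermIneq342_346 E termK C c δ₀ U) : TermIneq342_346NoLap E termK C c δ₀ U :=
  ⟨fun ω n lam y y' _ hf hl hs => h.1 ω n lam y y' hf hl hs, h.2⟩

/-- **«THEOREM 3.10 HOLDS FOR [the operator]» — Sect.-D form, one kernel family, one U**: the operator's designated expansion `E`
(print: of type (3.107), ω with a tree-like structure, p. 427) CONVERGES at U (`Converges`), every ω-term depends on U restricted
to X̃⁵₀ ∪ … ∪ X̃⁵ₙ (`LocDep`), and the ω-terms obey (3.108) and the corresponding inequalities for the norms of (3.42)–(3.46)
except the covariant-Laplacian entry (`TermIneq342_346NoLap`, `TermIneq343_345`; p. 427: *"The estimates are the same as in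
(3.108), d(ω, y, y′) is now a length of a shortest tree intersecting all domains Xᵢ in ω"*).
[cite: Balaban1985BackgroundPropagators, Thm 3.12 p.423, remark p.427, Thm 3.10 (3.107)–(3.108) pp.415–416] -/
def RWClause310NoLap (E : RWExpansion g B) (termK : E.Walk → KernelFamily g B) (C c δ₀ : ℝ)
    (Bβ Bε : ℝ → ℝ) (Bεβ : ℝ → ℝ → ℝ) (U : B.Cfg) : Prop :=
  E.Converges U ∧ (∀ ω : E.Walk, E.LocDep U ω) ∧
    TermIneq342_346NoLap E termK C c δ₀ U ∧ TermIneq343_345 E termK c δ₀ Bβ Bε Bεβ U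

/-- **PER-WALK (3.133) FOR AN H-KERNEL EXPANSION** — *"the inequality (3.133) together with Theorem 3.10 hold for the operators
H, H₁"* (p. 423) with p. 427 *"The estimates are the same as in (3.108) … We have the same situation for the operators H₁"*: the
walks of the kernel expansion `EH` (localisation: *"the cube Δ(y) and the point y′ in the case of H, H₁"*, p. 426) carry
ω-terms seen through their (3.133) quantities `termH ω : B9.HKernel` (sup over x ∈ Δ(y) of |H_{μν}(x,y′)|, |∇H_{μν}(x,y′)|;
‖ζ∇H(·,y′)‖_β), bounded by the (3.133) shape [1, (Lʲη)⁻¹, (‖ζ‖_β + |ζ|)(Lʲη)^{−1−β}](L^{j′}η)^{−d} times the walk factor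
O(1)(O(1)M^{−1/2})^{|ω|}M^{−1/2|ω|}e^{−½δ₀d(ω,y,y′)} (the exponential of (3.133) replaced by the walk's, as (3.108) replaces
(3.42)'s).  ζ ∈ C₀^∞(Δ̃(y)) (`cutInT`) as in `B9.Ineq3133`. [cite: Balaban1985BackgroundPropagators, Thm 3.12 p.423, (3.133) p.422, remark p.427] -/
def TermIneq3133 (d : ℕ) (EH : RWKernelExpansion g B) (termH : EH.Walk → HKernel g B) (C c δ₀ : ℝ) (Cβ : ℝ → ℝ)
    (U : B.Cfg) : Prop :=
  (∀ (ω : EH.Walk) (n : Fin 2) (y y' : g.Site),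
      (termH ω).e n U y y' ≤ (g.len y) ^ (-(n : ℝ)) * (g.len y') ^ (-(d : ℝ)) *
        walkFactor C c g.M δ₀ (EH.wlen ω) (EH.wdist ω y y')) ∧
  (∀ (ω : EH.Walk) (β : ℝ) (ζ : g.Cut) (y y' : g.Site), 0 ≤ β → β < 1 → g.cutInT ζ y →
      (termH ω).h U β ζ y' ≤ g.cutH β ζ * (g.len y) ^ (-(1 + β)) * (g.len y') ^ (-(d : ℝ)) *
        walkFactor (Cβ β) c g.M δ₀ (EH.wlen ω) (EH.wdist ω y y'))

/-- **«(3.133) TOGETHER WITH THEOREM 3.10 HOLD FOR H» — one H-kernel, one U**: the kernel expansion converges, its ω-terms are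
localized in U, and obey the per-walk (3.133) block. [cite: Balaban1985BackgroundPropagators, Thm 3.12 p.423, remark p.427] -/
def RWClauseH (d : ℕ) (EH : RWKernelExpansion g B) (termH : EH.Walk → HKernel g B) (C c δ₀ : ℝ) (Cβ : ℝ → ℝ)
    (U : B.Cfg) : Prop :=
  EH.Converges U ∧ (∀ ω : EH.Walk, EH.LocDep U ω) ∧ TermIneq3133 d EH termH C c δ₀ Cβ U

/-- **THEOREM 3.12 — THE RANDOM-WALK CLAUSES** (p. 423 [PDF 35], verbatim in the module docstring): for U in both regularity
classes (3.35), (3.36) with α₀ small (and M large — inherited from Theorem 3.10, as in `B9.Thm312Printed`), *"Theorem 3.10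
hold[s] for the propagators G, G₁"* — G = (Δ_π + DRD* + Q*aQ)⁻¹ (3.122), G₁ (3.128) of Sect. D (NOT the G of Thm 3.3, D-r1.2),
with their designated expansions `ED`, `E₁` (obtained from (3.130)∕(3.138) *"by inserting there the expansions of all
operators"*, tree-like ω, p. 427) and walk-indexed term families `termD`, `term₁`: `RWClause310NoLap` — and *"the inequality
(3.133) together with Theorem 3.10 hold for the operators H, H₁"* (H = GQ*(QGQ*)⁻¹ (3.126), H₁ (3.129)) with kernel expansions
`EH`, `EH₁` and term families `termH`, `termH₁`: `RWClauseH`.  Quantifier template of `B9.Thm312Printed`: constants M₄, a₀,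
the common best rate δ₀ (p. 423), the O(1)'s and B₀(·), B′₀(·), B′₀(·,·), C(β) BEFORE the member i and U.  The printed-shape
COMPANION of the abstract slots `HasRWExp`∕`HasRWExpH` of `B9.Thm312Printed` (to be carried beside it, never instead).
GAPS G-B9-16 (perturbation series (3.130)∕(3.138), one displayed estimate), G-B9-11.
[cite: Balaban1985BackgroundPropagators, Thm 3.12 pp.421–423, remark p.427] -/
def Thm312RWPrinted {I : Type} (d : ℕ) (c35 : ℝ) (geo : I → Geometry) (bg : I → Backgrounds)
    (ED E₁ : ∀ i, RWExpansion (geo i) (bg i))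
    (termD : ∀ i, (ED i).Walk → KernelFamily (geo i) (bg i)) (term₁ : ∀ i, (E₁ i).Walk → KernelFamily (geo i) (bg i))
    (EH EH₁ : ∀ i, RWKernelExpansion (geo i) (bg i))
    (termH : ∀ i, (EH i).Walk → HKernel (geo i) (bg i)) (termH₁ : ∀ i, (EH₁ i).Walk → HKernel (geo i) (bg i)) : Prop :=
  ∃ M₄ a₀ δ₀ C c : ℝ, ∃ Bβ Bε Cβ : ℝ → ℝ, ∃ Bεβ : ℝ → ℝ → ℝ, 0 < M₄ ∧ 0 < a₀ ∧ 0 < δ₀ ∧ 0 < C ∧ 0 < c ∧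
    ∀ i : I, M₄ ≤ (geo i).M → ∀ α₀ : ℝ, 0 < α₀ → (geo i).M * α₀ ≤ a₀ →
      ∀ U : (bg i).Cfg, (bg i).Reg335 c35 α₀ U → (bg i).Reg336 c35 α₀ U →
        RWClause310NoLap (ED i) (termD i) C c δ₀ Bβ Bε Bεβ U ∧
        RWClause310NoLap (E₁ i) (term₁ i) C c δ₀ Bβ Bε Bεβ U ∧
        RWClauseH d (EH i) (termH i) C c δ₀ Cβ U ∧ RWClauseH d (EH₁ i) (termH₁ i) C c δ₀ Cβ U

/-- **THEOREM 3.13 — THE RANDOM-WALK CLAUSE** (p. 426 [PDF 38], verbatim in the module docstring): for U in (3.35), (3.36) with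
α₀ small (M large inherited), *"Theorems 3.3, 3.10, 3.11 hold for the propagator 𝔊, with the exception of the inequality in
(3.42) involving the covariant Laplace operator"* — 𝔊 = 𝔓G₁ = G₁𝔓* (3.153) (*"Especially for 𝔊 we have, assuming (3.132)"*; the
reduction identities are `B9.frakG_3150`∕`frakG_3153`, kernel `B9Thm313RightEntries`): the Theorem-3.10 part as
`RWClause310NoLap` for 𝔊's designated expansion `EG` and term family `termG`.  Companion of the abstract slot `HasRWExp` of
`B9.Thm313Printed`. [cite: Balaban1985BackgroundPropagators, Thm 3.13 p.426, (3.153) p.426] -/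
def Thm313RWPrinted {I : Type} (c35 : ℝ) (geo : I → Geometry) (bg : I → Backgrounds)
    (EG : ∀ i, RWExpansion (geo i) (bg i)) (termG : ∀ i, (EG i).Walk → KernelFamily (geo i) (bg i)) : Prop :=
  ∃ M₄ a₀ δ₀ C c : ℝ, ∃ Bβ Bε : ℝ → ℝ, ∃ Bεβ : ℝ → ℝ → ℝ, 0 < M₄ ∧ 0 < a₀ ∧ 0 < δ₀ ∧ 0 < C ∧ 0 < c ∧
    ∀ i : I, M₄ ≤ (geo i).M → ∀ α₀ : ℝ, 0 < α₀ → (geo i).M * α₀ ≤ a₀ →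
      ∀ U : (bg i).Cfg, (bg i).Reg335 c35 α₀ U → (bg i).Reg336 c35 α₀ U →
        RWClause310NoLap (EG i) (termG i) C c δ₀ Bβ Bε Bεβ U

/-- **THE SUP ENTRY OF A SECT.-D CLAUSE** (the shape [Balaban1988RG2Cluster] (1.6)–(1.7) read for *"H, H₀, G̃"*,
`B13Sect1Statements.Eq16`∕`Ineq17` with `A y = (Lʲη)²`): from `RWClause310NoLap`, convergence, localisation and (3.108) for the
ω-terms (entry n = 0, prefactor (Lʲη)²). [cite: Balaban1985BackgroundPropagators, Thm 3.12 p.423, Thm 3.10 (3.108) p.416] -/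
theorem sup_entry_of_clause {E : RWExpansion g B} {termK : E.Walk → KernelFamily g B} {C c δ₀ : ℝ}
    {Bβ Bε : ℝ → ℝ} {Bεβ : ℝ → ℝ → ℝ} {U : B.Cfg} (h : RWClause310NoLap E termK C c δ₀ Bβ Bε Bεβ U) :
    E.Converges U ∧
      ∀ (ω : E.Walk) (J : g.Loc) (y y' : g.Site), E.first ω y → E.last ω y' → g.suppIn J y' →
        E.LocDep U ω ∧
          (termK ω).e 0 U J y ≤ (g.len y) ^ 2 * walkFactor C c g.M δ₀ (E.wlen ω) (E.wdist ω y y') * g.supNorm J := by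
  obtain ⟨hconv, hloc, h42, -⟩ := h
  refine ⟨hconv, fun ω J y y' hf hl hs => ⟨hloc ω, ?_⟩⟩
  have h0 := h42.1 ω 0 J y y' (by decide) hf hl hs
  rw [pref4_zero] at h0
  exact h0

/-! ## §2 Theorem 3.14 for the H-kernels and the site kernels -/

/-- A **(3.48)∕(3.132)-TYPE KERNEL BOUND WITH A LOCALISATION RESTRICTION AND AN EXTRA FACTOR** (pattern of
`B9Thm314.IneqSupF`): |K(y, y′)| ≤ C(Lʲη)^{−p}(L^{j′}η)^{−d}e^{−δd(y,y′)}·F(y, y′) for y, y′ with `P` (print: y, y′ ∈ Ω^{(k)});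
p = 4 is (3.48), p = 2 is (3.132), p = 0 with d = 0 the unit-lattice shape (3.187).
[cite: Balaban1985BackgroundPropagators, (3.48) p.398, (3.132) p.422, Thm 3.14 (3.154) pp.426–427] -/
def IneqKerF (d : ℕ) (K : SiteKernel g B) (C p δ : ℝ) (P : g.Site → Prop) (F : g.Site → g.Site → ℝ)
    (U : B.Cfg) : Prop :=
  ∀ y y' : g.Site, P y → P y' →
    |K.ker U y y'| ≤ C * (g.len y) ^ (-p) * (g.len y') ^ (-(d : ℝ)) * Real.exp (-(δ * g.dist y y')) * F y y'

/-- A **(3.133)-TYPE H-KERNEL BLOCK WITH A LOCALISATION RESTRICTION AND AN EXTRA FACTOR**: the three quantities of (3.133)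
(`B9.HKernel`: sup over x ∈ Δ(y) of |H_{μν}(x,y′)|, of |∇H_{μν}(x,y′)|, and ‖ζ∇H(·,y′)‖_β for ζ ∈ C₀^∞(Δ̃(y))) bounded by the
printed shapes of `B9.Ineq3133` times `F y y′`, for y, y′ with `P` (print: *"the cube Δ(y) and the point y′ in the case of H, H₁"*,
y, y′ ∈ Ω^{(k)}). [cite: Balaban1985BackgroundPropagators, (3.133) p.422, Thm 3.14 (3.154) pp.426–427] -/
def IneqHF (d : ℕ) (H : HKernel g B) (C : ℝ) (Cβ : ℝ → ℝ) (δ₁ : ℝ) (P : g.Site → Prop) (F : g.Site → g.Site → ℝ)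
    (U : B.Cfg) : Prop :=
  (∀ (n : Fin 2) (y y' : g.Site), P y → P y' →
      H.e n U y y' ≤ C * (g.len y) ^ (-(n : ℝ)) * (g.len y') ^ (-(d : ℝ)) *
        Real.exp (-(δ₁ / 2 * g.dist y y')) * F y y') ∧
  (∀ (β : ℝ) (ζ : g.Cut) (y y' : g.Site), 0 ≤ β → β < 1 → P y → P y' → g.cutInT ζ y →
      H.h U β ζ y' ≤ Cβ β * g.cutH β ζ * (g.len y) ^ (-(1 + β)) * (g.len y') ^ (-(d : ℝ)) *
        Real.exp (-(δ₁ / 2 * g.dist y y')) * F y y')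

/-- **THEOREM 3.14 FOR (Q′G′²Q′*)⁻¹** (pp. 426–427 [PDF 38–39]; *"the points y, y′ in the case of (Q′G′²Q′*)⁻¹"*): the difference
`Cdiff i` of the kernels (3.48) constructed for the two sequences {Ω_j}, {Ω′_j} satisfies *"all the inequalities characteristic
for operators of the considered type"* — the (3.48) shape B₀(Lʲη)⁻⁴(L^{j′}η)^{−d}e^{−δ₀d(y,y′)} — *"with the additional factor
exp(−δ₀d(y, y′, Ω))"* (3.154), for y, y′ ∈ Ω^{(k)} (`OmK`), under the hypotheses of Theorem 3.2 (M large, (3.35), Mα₀ ≤ a₀;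
constants BEFORE the member i = torus, k, both sequences, M).  GAPS G-B9-08∕19 (proof by reference to the theorem of [2] +
sketch; «after adjusting a definition of δ₀»).  CONVENTION OF RECORD (that of `B9.Thm314Printed` ∕ `B9Thm314`, named here at
lit-balaban-ref-2 g138's request §C-2): print's standing hypothesis of p. 426 — *"two sequences of domains {Ω_j}, {Ω′_j}, both
satisfying the conditions (2.1)–(2.4) in [4], with M and R sufficiently large, so that all the conditions needed in this paper
are satisfied. We construct operators for both sequences and we define Ω = Ω_k ∩ Ω′_k"* — is ABSORBED INTO THE FAMILY INDEX: a
member i IS (torus, k, the pair of sequences, M) with both sequences in the class (2.1)–(2.4) of [4] (no separate hypothesis is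
displayed; the M-threshold M₅ stays explicit), Ω^{(k)} for Ω = Ω_k ∩ Ω′_k is the member's predicate `OmK i`, and d(y, y′, Ω) of
(3.154) is its `dOmega i`. [cite: Balaban1985BackgroundPropagators, Thm 3.14 (3.154) pp.426–427, Thm 3.2 (3.48) p.398] -/
def Thm314CinvPrinted {I : Type} (d : ℕ) (c35 : ℝ) (geo : I → Geometry) (bg : I → Backgrounds)
    (Cdiff : ∀ i, SiteKernel (geo i) (bg i)) (OmK : ∀ i, (geo i).Site → Prop)
    (dOmega : ∀ i, (geo i).Site → (geo i).Site → ℝ) : Prop :=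
  ∃ M₅ δ₀ a₀ B₀ : ℝ, 0 < M₅ ∧ 0 < δ₀ ∧ 0 < a₀ ∧ 0 < B₀ ∧
    ∀ i : I, M₅ ≤ (geo i).M → ∀ α₀ : ℝ, 0 < α₀ → (geo i).M * α₀ ≤ a₀ →
      ∀ U : (bg i).Cfg, (bg i).Reg335 c35 α₀ U →
        IneqKerF d (Cdiff i) B₀ 4 δ₀ (OmK i) (fun y y' => Real.exp (-(δ₀ * dOmega i y y'))) U

/-- **THEOREM 3.14 FOR THE SECT.-D KERNELS (QGQ*)⁻¹, (QG₁Q*)⁻¹ AND THE OPERATORS H, H₁** (pp. 426–427 [PDF 38–39]; *"the cube Δ(y)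
and the point y′ in the case of H, H₁, and the points y, y′ in the case of … (QGQ*)⁻¹, etc."*): the differences for the two
sequences satisfy the inequalities characteristic for their type — (3.132): O(1)(Lʲη)⁻²(L^{j′}η)^{−d}e^{−δ₁d(y,y′)} for the two
site kernels (`Qdiff`, `Q₁diff`), (3.133) for the H-kernels (`Hdiff`, `H₁diff`) — with the additional factor exp(−δ₀d(y, y′, Ω))
and for y, y′ ∈ Ω^{(k)}, under the hypotheses of Theorem 3.12 (M large, (3.35) and (3.36), α₀ small); one common rate δ₀ (p. 423
*"a common, best possible, decay rate for all these operators"*).  GAPS G-B9-08∕19, G-B9-15 ((3.132) by analogy).  Same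
CONVENTION OF RECORD as `Thm314CinvPrinted` (ref-2 g138 §C-2): the (2.1)–(2.4)-of-[4] hypothesis on both sequences is absorbed into
the family index i, Ω^{(k)} is `OmK i`, d(y, y′, Ω) is `dOmega i`.
[cite: Balaban1985BackgroundPropagators, Thm 3.14 (3.154) pp.426–427, (3.132)–(3.133) p.422, Thm 3.12 p.423] -/
def Thm314SectDKernelsPrinted {I : Type} (d : ℕ) (c35 : ℝ) (geo : I → Geometry) (bg : I → Backgrounds)
    (Qdiff Q₁diff : ∀ i, SiteKernel (geo i) (bg i)) (Hdiff H₁diff : ∀ i, HKernel (geo i) (bg i))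
    (OmK : ∀ i, (geo i).Site → Prop) (dOmega : ∀ i, (geo i).Site → (geo i).Site → ℝ) : Prop :=
  ∃ M₅ δ₀ a₀ C : ℝ, ∃ Cβ : ℝ → ℝ, 0 < M₅ ∧ 0 < δ₀ ∧ 0 < a₀ ∧ 0 < C ∧
    ∀ i : I, M₅ ≤ (geo i).M → ∀ α₀ : ℝ, 0 < α₀ → (geo i).M * α₀ ≤ a₀ →
      ∀ U : (bg i).Cfg, (bg i).Reg335 c35 α₀ U → (bg i).Reg336 c35 α₀ U →
        IneqKerF d (Qdiff i) C 2 δ₀ (OmK i) (fun y y' => Real.exp (-(δ₀ * dOmega i y y'))) U ∧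
        IneqKerF d (Q₁diff i) C 2 δ₀ (OmK i) (fun y y' => Real.exp (-(δ₀ * dOmega i y y'))) U ∧
        IneqHF d (Hdiff i) C Cβ δ₀ (OmK i) (fun y y' => Real.exp (-(δ₀ * dOmega i y y'))) U ∧
        IneqHF d (H₁diff i) C Cβ δ₀ (OmK i) (fun y y' => Real.exp (-(δ₀ * dOmega i y y'))) U

/-- Bookkeeping (by unfolding): with the restriction `OmK ≡ True` the (Q′G′²Q′*)⁻¹ statement is the unrestricted reading — the
relation `B9Thm314.thm314Printed_iff_supOn_univ` records for the `KernelFamily`-type statement. [cite: Balaban1985BackgroundPropagators, Thm 3.14 pp.426–427] -/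
theorem thm314Cinv_iff_univ {I : Type} {d : ℕ} {c35 : ℝ} {geo : I → Geometry} {bg : I → Backgrounds}
    {Cdiff : ∀ i, SiteKernel (geo i) (bg i)} {dOmega : ∀ i, (geo i).Site → (geo i).Site → ℝ} :
    Thm314CinvPrinted d c35 geo bg Cdiff (fun _ _ => True) dOmega ↔
      ∃ M₅ δ₀ a₀ B₀ : ℝ, 0 < M₅ ∧ 0 < δ₀ ∧ 0 < a₀ ∧ 0 < B₀ ∧
        ∀ i : I, M₅ ≤ (geo i).M → ∀ α₀ : ℝ, 0 < α₀ → (geo i).M * α₀ ≤ a₀ →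
          ∀ U : (bg i).Cfg, (bg i).Reg335 c35 α₀ U → ∀ y y' : (geo i).Site,
            |(Cdiff i).ker U y y'| ≤ B₀ * ((geo i).len y) ^ (-(4 : ℝ)) * ((geo i).len y') ^ (-(d : ℝ)) *
              Real.exp (-(δ₀ * (geo i).dist y y')) * Real.exp (-(δ₀ * dOmega i y y')) := by
  simp only [Thm314CinvPrinted, IneqKerF, true_implies]

/-! ## §3 Sect. E: the γ₀ sentence of p. 428 and Theorem 3.15's expansion clause -/

/-- **THE γ₀ SENTENCE OF p. 428** [PDF 40] (verbatim in the module docstring): *"a positive definite operator C*Δ_kC with a lower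
bound γ₀ > 0 independent of k and U. We have proved it in [4], Lemma 2.4, for operators with U = 1. Localizing the operators in
Δ_k and using the methods of Sect. B we can prove it for C*Δ_kC with an arbitrary configuration U satisfying (3.35), (3.36)
with Mα₀ sufficiently small."* — `Coercive i U γ` = «⟨B̃, C*Δ_kC B̃⟩ ≥ γ‖B̃‖² on the parametrizing variables B̃ of (3.156)»
(abstract, supplied by the user; Δ_k = the form (3.156) of member i, which carries k, {Ω_j}, Λ); QUANTIFIER ORDER: γ₀ (and the
smallness threshold a₀) BEFORE the member i ∋ k and BEFORE U; no M-threshold is printed here (the standing *"M and R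
sufficiently large, so that all the conditions needed in this paper are satisfied"* of p. 426 is a property of the family I, as
for `B9.Thm315Printed`).  GAPS G-B9-09 (OBJECTION of record: asserted, proof indicated not given; U = 1 is [4] Lemma 2.4, itself
G-B6-08); the LOGIC of the cell's repair is `B9SectEKernel.gamma0_assembly` ∕ `coercive_sandwich_of_range` (G-B9-09R) — cited,
not restated.  A hypothesis slot, never asserted. [cite: Balaban1985BackgroundPropagators, p.428 (after (3.158)); Balaban1984PropagatorsII, Lemma 2.4 p.249] -/
def ClaimP428GammaZeroPrinted {I : Type} (c35 : ℝ) (geo : I → Geometry) (bg : I → Backgrounds)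
    (Coercive : ∀ i, (bg i).Cfg → ℝ → Prop) : Prop :=
  ∃ γ₀ a₀ : ℝ, 0 < γ₀ ∧ 0 < a₀ ∧
    ∀ i : I, ∀ α₀ : ℝ, 0 < α₀ → (geo i).M * α₀ ≤ a₀ →
      ∀ U : (bg i).Cfg, (bg i).Reg335 c35 α₀ U → (bg i).Reg336 c35 α₀ U → Coercive i U γ₀

/-- **THEOREM 3.15 — THE EXPANSION CLAUSE** (p. 432 [PDF 44], verbatim in the module docstring): *"For Mα₀ sufficiently small the
propagator C^{(k)}(Λ) … has a convergent random walk expansion of the type described previously. Of course we have all the other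
consequences following from the random walk expansion."* (preceded by *"Expanding these into random walks we get a random walk
expansion of C^{(k)}(Λ)"*) — typed for the designated kernel expansion `EC i : B9.RWKernelExpansion` of C^{(k)}(Λ) on Λ (`inΛ`):
CONVERGENT at U, every ω-term depending on U restricted to X̃⁵₀ ∪ … ∪ X̃⁵ₙ, and — READING OF RECORD of «the type described
previously» (`B9.Thm37_39_310Printed`: «expansion exists, converges in all the norms, terms localised with bound
(3.94)∕(3.99)∕(3.108)»; the per-term display is NOT printed for C^{(k)}(Λ) on p. 432) — the ω-term's kernel entry bounded by the
(3.99)-pattern at the unit scale, O(1)(O(1)M^{−1/2})^{|ω|}M^{−1/2|ω|}e^{−½δ₀d(ω,y,y′)} (`B9.walkFactor`), for y, y′ ∈ Λ.  Hypotheses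
and quantifier template of `B9.Thm315FullPrinted` ((3.35), (3.36), Mα₀ ≤ a₀; constants BEFORE i).  The printed-shape companion
of the abstract slot `HasRWExpC`.  GAPS G-B9-10 (the G₂ − G₁ perturbation undisplayed; kernel companion
`B9Eq3186G2Perturbation`), G-B9-09.  v1.1 NOTES OF RECORD: (a) lit-balaban-ref-2 g138 GAP-STATED(this decl) — the per-term display
is a READING, not on p. 432; the verbatim core is `Thm315RWCorePrinted` (§4), implied by this decl (`thm315RWCore_of_expansion`);
(b) dag-ref-E READ-7 A3 WATCH — no M-threshold is printed in Theorem 3.15, and `B9.walkFactor` carries the REAL powers M^{−1/2},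
M^{−n/2}: at a would-be member with (geo i).M ≤ 0 (never a member of the paper's families, p. 426 *«M and R sufficiently large»*;
`B9.Geometry.M : ℝ` has no sign field) `Real.rpow`'s junk value makes the bound degenerate (e.g. ≤ 0 for |ω| = 1) — instantiate
at families with M > 0 (`walkFactor_pos`), or carry the thresholded reading `Thm315RWExpansionLargeMPrinted` (§4).
[cite: Balaban1985BackgroundPropagators, Thm 3.15 (3.185)–(3.187) p.432, Thm 3.9 (3.98)–(3.99) p.413] -/
def Thm315RWExpansionPrinted {I : Type} (c35 : ℝ) (geo : I → Geometry) (bg : I → Backgrounds)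
    (inΛ : ∀ i, (geo i).Site → Prop) (EC : ∀ i, RWKernelExpansion (geo i) (bg i)) : Prop :=
  ∃ δ₀ a₀ C c : ℝ, 0 < δ₀ ∧ 0 < a₀ ∧ 0 < C ∧ 0 < c ∧
    ∀ i : I, ∀ α₀ : ℝ, 0 < α₀ → (geo i).M * α₀ ≤ a₀ →
      ∀ U : (bg i).Cfg, (bg i).Reg335 c35 α₀ U → (bg i).Reg336 c35 α₀ U →
        (EC i).Converges U ∧ (∀ ω : (EC i).Walk, (EC i).LocDep U ω) ∧
        ∀ (ω : (EC i).Walk) (y y' : (geo i).Site), inΛ i y → inΛ i y' →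
          |(EC i).kterm U ω y y'| ≤ walkFactor C c (geo i).M δ₀ ((EC i).wlen ω) ((EC i).wdist ω y y')

/-- Projection (kernel-checked): the verbatim core of the clause — *"has a convergent random walk expansion"* with localized
terms — without the per-term reading. [cite: Balaban1985BackgroundPropagators, Thm 3.15 p.432] -/
theorem thm315RW_converges {I : Type} {c35 : ℝ} {geo : I → Geometry} {bg : I → Backgrounds}
    {inΛ : ∀ i, (geo i).Site → Prop} {EC : ∀ i, RWKernelExpansion (geo i) (bg i)}
    (h : Thm315RWExpansionPrinted c35 geo bg inΛ EC) :
    ∃ a₀ : ℝ, 0 < a₀ ∧ ∀ i : I, ∀ α₀ : ℝ, 0 < α₀ → (geo i).M * α₀ ≤ a₀ →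
      ∀ U : (bg i).Cfg, (bg i).Reg335 c35 α₀ U → (bg i).Reg336 c35 α₀ U →
        (EC i).Converges U ∧ ∀ ω : (EC i).Walk, (EC i).LocDep U ω := by
  obtain ⟨δ₀, a₀, C, c, -, ha, -, -, H⟩ := h
  exact ⟨a₀, ha, fun i α₀ hα hMa U hU hU' => ⟨(H i α₀ hα hMa U hU hU').1, (H i α₀ hα hMa U hU hU').2.1⟩⟩

/-! ## §4 (v1.1) Theorem 3.15's VERBATIM CORE, the thresholded reading, and the sign of the walk factor -/

/-- **THEOREM 3.15 — THE VERBATIM CORE OF THE EXPANSION CLAUSE** (p. 432 [PDF 44]): *"Theorem 3.15. For Mα₀ sufficiently small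
the propagator C^{(k)}(Λ) is given by the formula (3.185), and satisfies the bound |C^{(k)}(Λ; y, y′)| ≤ B₀e^{−δ₀|y−y′|}, y, y′ ∈ Λ
(3.187) with the constants B₀, δ₀ depending on d and L only. This propagator has a convergent random walk expansion of the type
described previously."* (preceded by *"Expanding these into random walks we get a random walk expansion of C^{(k)}(Λ)"*) — WHAT
THE PAGE LITERALLY ASSERTS about the expansion, and nothing more: the designated kernel expansion `EC i` of C^{(k)}(Λ) CONVERGES
at U and each ω-term depends on U restricted to X̃⁵₀ ∪ … ∪ X̃⁵ₙ (the localisation that «of the type described previously»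
names in Theorems 3.7∕3.9∕3.10), for U in (3.35), (3.36) with Mα₀ ≤ a₀ (a₀ BEFORE the member i; no M-threshold printed; no
per-term display — that READING is `Thm315RWExpansionPrinted`, which implies this core: `thm315RWCore_of_expansion`).  The bound
(3.187) itself is r1's `B9.Thm315Printed`.  Added at lit-balaban-ref-2 g138's request (§C-1, GAP-STATED on
`Thm315RWExpansionPrinted`); the body is, by `rfl`, the conclusion of v1's `thm315RW_converges`.  GAPS G-B9-10, G-B9-09.
[cite: Balaban1985BackgroundPropagators, Thm 3.15 p.432] -/
def Thm315RWCorePrinted {I : Type} (c35 : ℝ) (geo : I → Geometry) (bg : I → Backgrounds)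
    (EC : ∀ i, RWKernelExpansion (geo i) (bg i)) : Prop :=
  ∃ a₀ : ℝ, 0 < a₀ ∧ ∀ i : I, ∀ α₀ : ℝ, 0 < α₀ → (geo i).M * α₀ ≤ a₀ →
    ∀ U : (bg i).Cfg, (bg i).Reg335 c35 α₀ U → (bg i).Reg336 c35 α₀ U →
      (EC i).Converges U ∧ ∀ ω : (EC i).Walk, (EC i).LocDep U ω

/-- **`thm315RW_converges` RESTATED AGAINST THE CORE** (ref-2 g138 §C-1; kernel-checked, `rfl` on the body): the reading of record
implies the verbatim core. [cite: Balaban1985BackgroundPropagators, Thm 3.15 p.432] -/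
theorem thm315RWCore_of_expansion {I : Type} {c35 : ℝ} {geo : I → Geometry} {bg : I → Backgrounds}
    {inΛ : ∀ i, (geo i).Site → Prop} {EC : ∀ i, RWKernelExpansion (geo i) (bg i)}
    (h : Thm315RWExpansionPrinted c35 geo bg inΛ EC) : Thm315RWCorePrinted c35 geo bg EC :=
  thm315RW_converges h

/-- **THE SIGN OF THE WALK FACTOR** (bookkeeping for dag-ref-E's A3 watch): for positive O(1)'s and M > 0 the printed walk factor
O(1)(O(1)M^{−1/2})^{|ω|}M^{−1/2|ω|}e^{−½δ₀d(ω,y,y′)} is > 0 — at the paper's members (M ≥ 1 large) no `Real.rpow` junk occurs.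
[cite: Balaban1985BackgroundPropagators, (3.94) p.410, (3.99) p.413 (bookkeeping)] -/
theorem walkFactor_pos {C c M : ℝ} (hC : 0 < C) (hc : 0 < c) (hM : 0 < M) (δ₀ : ℝ) (n : ℕ) (dω : ℝ) :
    0 < walkFactor C c M δ₀ n dω :=
  mul_pos (mul_pos (mul_pos hC (pow_pos (mul_pos hc (Real.rpow_pos_of_pos hM _)) n)) (Real.rpow_pos_of_pos hM _))
    (Real.exp_pos _)

/-- **THEOREM 3.15'S EXPANSION CLAUSE, THRESHOLDED READING** (dag-ref-E READ-7 A3 watch): the reading `Thm315RWExpansionPrinted`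
with p. 426's standing *"with M and R sufficiently large, so that all the conditions needed in this paper are satisfied"* made an
explicit threshold `M₅ ≤ (geo i).M`, 0 < M₅, BEFORE the member — the shape of `Thm312RWPrinted`'s M₄ and of r1's Theorem-3.10
template — so that the walk factor is evaluated only at M ≥ M₅ > 0 (`walkFactor_pos`).  WEAKER than `Thm315RWExpansionPrinted`
(`thm315RWLargeM_of_expansion`); same constants δ₀, a₀, C, c before i; per-term display = the same READING ((3.99)-pattern at
the unit scale, not printed on p. 432 — see `Thm315RWCorePrinted` for the verbatim core).
[cite: Balaban1985BackgroundPropagators, Thm 3.15 p.432, p.426 (standing «M and R sufficiently large»), Thm 3.9 (3.99) p.413] -/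
def Thm315RWExpansionLargeMPrinted {I : Type} (c35 : ℝ) (geo : I → Geometry) (bg : I → Backgrounds)
    (inΛ : ∀ i, (geo i).Site → Prop) (EC : ∀ i, RWKernelExpansion (geo i) (bg i)) : Prop :=
  ∃ M₅ δ₀ a₀ C c : ℝ, 0 < M₅ ∧ 0 < δ₀ ∧ 0 < a₀ ∧ 0 < C ∧ 0 < c ∧
    ∀ i : I, M₅ ≤ (geo i).M → ∀ α₀ : ℝ, 0 < α₀ → (geo i).M * α₀ ≤ a₀ →
      ∀ U : (bg i).Cfg, (bg i).Reg335 c35 α₀ U → (bg i).Reg336 c35 α₀ U →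
        (EC i).Converges U ∧ (∀ ω : (EC i).Walk, (EC i).LocDep U ω) ∧
        ∀ (ω : (EC i).Walk) (y y' : (geo i).Site), inΛ i y → inΛ i y' →
          |(EC i).kterm U ω y y'| ≤ walkFactor C c (geo i).M δ₀ ((EC i).wlen ω) ((EC i).wdist ω y y')

/-- Bookkeeping (kernel-checked): the unthresholded reading implies the thresholded one (take M₅ := 1 and forget the threshold).
[cite: Balaban1985BackgroundPropagators, Thm 3.15 p.432 (bookkeeping)] -/
theorem thm315RWLargeM_of_expansion {I : Type} {c35 : ℝ} {geo : I → Geometry} {bg : I → Backgrounds}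
    {inΛ : ∀ i, (geo i).Site → Prop} {EC : ∀ i, RWKernelExpansion (geo i) (bg i)}
    (h : Thm315RWExpansionPrinted c35 geo bg inΛ EC) : Thm315RWExpansionLargeMPrinted c35 geo bg inΛ EC := by
  obtain ⟨δ₀, a₀, C, c, hδ, ha, hC, hc, H⟩ := h
  exact ⟨1, δ₀, a₀, C, c, one_pos, hδ, ha, hC, hc, fun i _ α₀ hα hMa U hU hU' => H i α₀ hα hMa U hU hU'⟩

/-- Bookkeeping (kernel-checked): at the threshold the walk factor of every term is positive — the A3 point in the kernel: under
`Thm315RWExpansionLargeMPrinted` the right-hand side of the per-term reading is never the `rpow` junk value.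
[cite: Balaban1985BackgroundPropagators, Thm 3.15 p.432, (3.99) p.413 (bookkeeping)] -/
theorem thm315RWLargeM_walkFactor_pos {I : Type} {c35 : ℝ} {geo : I → Geometry} {bg : I → Backgrounds}
    {inΛ : ∀ i, (geo i).Site → Prop} {EC : ∀ i, RWKernelExpansion (geo i) (bg i)}
    (h : Thm315RWExpansionLargeMPrinted c35 geo bg inΛ EC) :
    ∃ M₅ δ₀ C c : ℝ, 0 < M₅ ∧ ∀ i : I, M₅ ≤ (geo i).M →
      ∀ (n : ℕ) (dω : ℝ), 0 < walkFactor C c (geo i).M δ₀ n dω := by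
  obtain ⟨M₅, δ₀, a₀, C, c, hM, -, -, hC, hc, -⟩ := h
  exact ⟨M₅, δ₀, C, c, hM, fun i hMi n dω => walkFactor_pos hC hc (lt_of_lt_of_le hM hMi) δ₀ n dω⟩

end Literature.MathematicalPhysics.QuantumFieldTheory.Balaban1983to89.B9SectDERandomWalkClauses
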